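import Mathlib
import HarnessLib
import Summits.HubbardSuperconductivity.HubbardSuperconductivity.Theorems.KLProgrammeKLRegimeEngineTwoLegStepV17F2ClosersGQJ
import Summits.HubbardSuperconductivity.HubbardSuperconductivity.Theorems.KLProgrammeKLRegimeEngineV8TowerExports

/-!
# Route `KLProgramme` — ENGINE child gen 8 (stmt-HubbardSuperconductivity-20437 `KLRegimeEngineV17F2`), SKELETON v2, CLASS #7 (plan g17 (R47m), KL STATUS
# 2026-08-27T15:09:16Z): the TWO-LEG MOMENTS EXPORT `TwoLegDualMomentsAt` — the (b) → (e) internal currency for stub (e)'s residual B, its consumers, and the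
# TowerExports-style step Prop / deferred constants (cell gate-hubbard-kl, seat hubbard-kl-r2d-p1 g7 = TEXT OWNER; CANDIDATE — in the 09-01 bundle iff the
# E1 lanes' 08-29 price word is YES; SHAPE of §3–§4 to be signed off by the producer lanes r2d-p2 / k3c2-p3 / p3 / p4)

WHY ((R47j)/(R47m); B-SUPPLIER-e v2 = evidence #26 on 20437).  Stub (e) `stub_twoLeg_step` (n ≥ 1) needs, besides stub (C)'s jets and the two-volume legs, the
two SLOPES of `TwoLegSlopes … (K_n) n` — field strength `|z_n(K_n)(k) − 1| ≤ cz|U|` and the shell-tube gradient of the `K_n`-separated reading — i.e. two FIRST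
MOMENTS of the two-leg kernel of `𝒱⁽ⁿ⁾[K_n] − 𝒩_{K_n}`.  They are the `m = 2` line of the SAME sectorised multiscale induction that proves stub (b) at the fixed
frame `K_n` (v1 hands (e) no weighted two-leg datum: `KernelNormsWt4` carves `m = 2`, `EngineBoundsAtV17F2` is unweighted), so they are an EXPORT of (b),
consumed by (e) through this lane's dual-lattice shell `stub_twoLeg_step_of_dualMoments_GQ[J]` (p540781 / p546067).  This file is the export's TEXT:

* §1 **`TwoLegMomentsAt L M Zt Zs β U μ K n`** (frame-generic atom) := for both spins `σ` and every pin `x₀`, the circular TIME first moment of the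
  trivial-multiplier position-space two-leg kernel of `G' := klEffectiveAction … K klE0 n − counterQuadratic … K` is `≤ Zt·U²` AND its off-diagonal first
  SPACE moment is `≤ Zs·U²` — the two sums VERBATIM the hypotheses `hMt`/`hMs` of `stub_twoLeg_step_of_dualMoments_GQ` (budgets `Mt := Zt·U²`,
  `Ms := Zs·U²`); **`TwoLegDualMomentsAt L M Zt Zs β U μ n`** := the atom at the flow frame `K_n := klFlowFrameU L M β U μ n` (THE CLASS-#7 EXPORT; the two
  budget coefficients are explicit reals — G/P/Q-free like `LevelsUAt`'s table — and the skeleton instantiates them at closed terms, §4); `.mono`, `_iff`;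
* §2 CONSUMERS (ns `EngineV8`): `twoLeg_slopeSizes_of_twoLegMomentsAt` (any `K`, any `n`: the atom ⇒ `|klFieldStrength … K n k − 1| ≤ 2Zt·U²` at every
  torus momentum and `‖fderiv (evalM (symInterp L (klLocSelfEnergyRe … K n − K∘p))) q‖ ≤ 2Zs·U²` at every `q`, by p3's/this lane's bridges);
  **`stub_twoLeg_step_of_twoLegDualMomentsAt_GQJ`** — stub (e)'s literal binders at `(G, Q, cJ, cJ')` + thresholds (the `_GQJ` convention) with residual B
  replaced by `hD : TwoLegDualMomentsAt L M Zt Zs β U μ n` and the ALLOWANCE rows `2Zt ≤ 2^10·e¹⁸κ₀⁴·klE3Acum R`, `2Zs ≤ 2^11·…` (no new coupling door: the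
  registered `klEngU₀9/10 ≤ klE3U₀all R` pays) + C1/C2 ⇒ `TwoLegStepV17F2 L M G P Q R β U μ n`; and the GENERIC-THRESHOLD twin
  **`stub_twoLeg_step_of_twoLegDualMomentsAt_thr_GQJ`** — the allowance rows and the `klE3U₀all` door replaced by ONE coupling door
  `U₀c ≤ klTwoLegMomU R Zt Zs := cz·(23/200)/(2(|Zt|+|Zs|) + (4/3)|Gfr₁| + 1)` (`klTwoLegMomU_pos`, `twoLegMoment_fits_of_le_klTwoLegMomU`) — for DEFERRED
  budgets, whose size against `klE3Acum R` nobody can certify in advance;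
* §3 the STEP Prop **`TwoLegMomentsStep P R Q₀ Zt Zs u`** (VERBATIM the binder list of `LevelsUStep` (…EngineV8TowerExports §3): every `G` with `G.WF`, every
  raised `r ≥ Q₀.CR`, the engine-flow stub binders, the v1 door `klEngU₀9` AND the step's own deferred threshold `U ≤ u r cc`, history
  `HistP klPredsV17F2 … (Q₀.withCR r) … 0 n`, `FrameOK … (K_n)`, the export at every `j < n`) ⟹ `TwoLegDualMomentsAt L M Zt Zs β U μ n`;
  `IsMomentsPkg (Zt, Zs, u)` := `0 ≤ Zt ∧ 0 ≤ Zs ∧ ∀ r cc, 0 < u r cc`;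
* §4 the DEFERRED PACKAGE `klTwoLegMomPkg P R Q₀` (`dite` on `∃ e, IsMomentsPkg e ∧ TwoLegMomentsStep P R Q₀ e.1 e.2.1 e.2.2`, else `(0, 0, 1)`) with projections
  **`klC2t`**, **`klC2s`** (moment coefficients), **`klC2u`** (step threshold), unconditional `klC2t_nonneg`/`klC2s_nonneg`/`klC2u_pos`,
  `twoLegMomentsStep_klC2_of_exists/_of` (`choose_spec`), and the U-DOOR ENTRY CANDIDATE **`klC2U P R Q₀ r cc := min (klC2u …) (klTwoLegMomU R (klC2t …) (klC2s …))`**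
  (`klC2U_pos`, `klC2U_le_klC2u`, `klC2U_le_klTwoLegMomU`) — what `klEngU₀10` would take one more `min` with if #7 is bought in the generic-threshold form.

v2 WIRING IF BOUGHT (token «(b)-HDUAL», skeleton-internal, NOT a `klPredsV17F2` clause): (b) v2 conclusion `… ∧ TwoLegDualMomentsAt L M (klC2t P R Q₇) (klC2s P R Q₇) β U μ n`
(`Q₇ := klEngQ7 P R`), (e) v2 hypothesis the same text, (e) v2 closer = `stub_twoLeg_step_of_twoLegDualMomentsAt_thr_GQJ` under the door `klC2U` (or `_GQJ` under the
allowance, if the producer certifies `2·klC2t ≤ 2^10·e¹⁸κ₀⁴·klE3Acum R`).  Definitions with bodies + proofs; nothing about the model is asserted; nothing asserts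
superconductivity.  References: BGM 2006 §2.1 (2.4)–(2.5), §2.4 (2.36), §2.6 (2.98) [cite: BenfattoGiulianiMastropietro2006].
-/

noncomputable section

namespace Summit.HubbardSuperconductivity.HubbardSuperconductivity.Theorems.KLRegimeSplit

set_option linter.dupNamespace false -- summit = problem name (single-conjunct summit), D-0017

open Finset Complex
open Literature.MathematicalPhysics.QuantumLattice Literature.Probability.LatticeModels GrassmannAlgebra
open Literature.MathematicalPhysics.QuantumLattice.BandSectorCounting
open Summit.HubbardSuperconductivity.HubbardSuperconductivity.Theorems.KLProgrammeLegKernels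

/-! ## §1 The two-leg moments atom and the class-#7 export -/

section Model

variable (L M : ℕ) [NeZero L]

/-- **`TwoLegMomentsAt L M Zt Zs β U μ K n`** — at frame `K`, scale `n`, with `G' := klEffectiveAction L M β U μ K klE0 n − counterQuadratic L M β K` and its
trivial-multiplier position-space two-leg kernel `W(σ; x) := sectorisedKernel L M β (trivialMultiplier L M) G' 2 ((0,σ,+),(0,σ,−)) x`: for both spins `σ` and every
pin `x₀`, (time) `ε·Σ_{x : x 0 = x₀} ε·circDist_{2M}(j₀, j₁)·‖W(σ; x)‖ ≤ Zt·U²` and (space) `ε·Σ_{x : x 0 = x₀, x⃗₁ ≠ x⃗₀} (1+|Δx̃₀|+|Δx̃₁|)·‖W(σ; x)‖ ≤ Zs·U²`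
(`ε = imagTimeWeight β M`) — VERBATIM the `hMt`/`hMs` rows of `stub_twoLeg_step_of_dualMoments_GQ` with `Mt := Zt·U²`, `Ms := Zs·U²`. -/
def TwoLegMomentsAt (Zt Zs : ℝ) (β U μ : ℝ) (K : TrigPolyC4v) (n : ℕ) : Prop :=
  (∀ (σ : Fin 2) (x₀ : SpaceTimeIdx L M), imagTimeWeight β M *
      ∑ x ∈ (univ : Finset (Fin 2 → SpaceTimeIdx L M)).filter (fun x => x 0 = x₀),
        imagTimeWeight β M * (circDist (2 * M) (x 0).1.val (x 1).1.val : ℝ) *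
          ‖sectorisedKernel L M β (trivialMultiplier L M) (klEffectiveAction L M β U μ K klE0 n - counterQuadratic L M β K) 2
            (![((0, σ), 0), ((0, σ), 1)] : Fin 2 → SectorLeg 1) x‖ ≤ Zt * U ^ 2) ∧
  (∀ (σ : Fin 2) (x₀ : SpaceTimeIdx L M), imagTimeWeight β M *
      ∑ x ∈ (univ : Finset (Fin 2 → SpaceTimeIdx L M)).filter (fun x => x 0 = x₀ ∧ (x 1).2 ≠ (x 0).2),
        (1 + ((((x 1).2 - (x 0).2) 0).valMinAbs.natAbs : ℝ) + ((((x 1).2 - (x 0).2) 1).valMinAbs.natAbs : ℝ)) ^ 1 *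
          ‖sectorisedKernel L M β (trivialMultiplier L M) (klEffectiveAction L M β U μ K klE0 n - counterQuadratic L M β K) 2
            (![((0, σ), 0), ((0, σ), 1)] : Fin 2 → SectorLeg 1) x‖ ≤ Zs * U ^ 2)

variable {L M}

/-- Budget monotonicity of the atom. -/
theorem TwoLegMomentsAt.mono {Zt Zs Zt' Zs' β U μ : ℝ} {K : TrigPolyC4v} {n : ℕ} (h : TwoLegMomentsAt L M Zt Zs β U μ K n)
    (ht : Zt ≤ Zt') (hs : Zs ≤ Zs') : TwoLegMomentsAt L M Zt' Zs' β U μ K n :=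
  ⟨fun σ x₀ => (h.1 σ x₀).trans (mul_le_mul_of_nonneg_right ht (sq_nonneg U)),
    fun σ x₀ => (h.2 σ x₀).trans (mul_le_mul_of_nonneg_right hs (sq_nonneg U))⟩

variable (L M) [NeZero M]

/-- **`TwoLegDualMomentsAt L M Zt Zs β U μ n`** — THE CLASS-#7 EXPORT of the one-shot tower at scale `n`: the two-leg moments atom at the flow frame
`K_n := klFlowFrameU L M β U μ n` (the m = 2 line of stub (b)'s sectorised induction, read unsectorised on the dual lattice). -/
def TwoLegDualMomentsAt (Zt Zs : ℝ) (β U μ : ℝ) (n : ℕ) : Prop :=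
  TwoLegMomentsAt L M Zt Zs β U μ (klFlowFrameU L M β U μ n) n

variable {L M}

/-- The export IS the atom at the flow frame. -/
theorem twoLegDualMomentsAt_iff (Zt Zs β U μ : ℝ) (n : ℕ) :
    TwoLegDualMomentsAt L M Zt Zs β U μ n ↔ TwoLegMomentsAt L M Zt Zs β U μ (klFlowFrameU L M β U μ n) n := Iff.rfl

/-- Budget monotonicity of the export. -/
theorem TwoLegDualMomentsAt.mono {Zt Zs Zt' Zs' β U μ : ℝ} {n : ℕ} (h : TwoLegDualMomentsAt L M Zt Zs β U μ n)
    (ht : Zt ≤ Zt') (hs : Zs ≤ Zs') : TwoLegDualMomentsAt L M Zt' Zs' β U μ n :=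
  TwoLegMomentsAt.mono h ht hs

/-- The two budgets of the atom are nonnegative as soon as `U ≠ 0` and `0 ≤ β` (the moment sums are nonnegative; pin `x₀ = 0`). -/
theorem TwoLegMomentsAt.budget_nonneg {Zt Zs β U μ : ℝ} {K : TrigPolyC4v} {n : ℕ} (h : TwoLegMomentsAt L M Zt Zs β U μ K n)
    (hβ : 0 ≤ β) (hU : U ≠ 0) : 0 ≤ Zt ∧ 0 ≤ Zs := by
  have hε : 0 ≤ imagTimeWeight β M := imagTimeWeight_nonneg hβ M
  have hU2 : 0 < U ^ 2 := by positivity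
  refine ⟨?_, ?_⟩
  · have h0 : 0 ≤ Zt * U ^ 2 :=
      le_trans (mul_nonneg hε (sum_nonneg fun x _ => mul_nonneg (mul_nonneg hε (Nat.cast_nonneg _)) (norm_nonneg _)))
        (h.1 0 (0 : SpaceTimeIdx L M))
    nlinarith [h0, hU2]
  · have h0 : 0 ≤ Zs * U ^ 2 :=
      le_trans (mul_nonneg hε (sum_nonneg fun x _ => mul_nonneg (pow_nonneg (by positivity) 1) (norm_nonneg _)))
        (h.2 0 (0 : SpaceTimeIdx L M))
    nlinarith [h0, hU2]

/-- The same for the export. -/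
theorem TwoLegDualMomentsAt.budget_nonneg {Zt Zs β U μ : ℝ} {n : ℕ} (h : TwoLegDualMomentsAt L M Zt Zs β U μ n) (hβ : 0 ≤ β)
    (hU : U ≠ 0) : 0 ≤ Zt ∧ 0 ≤ Zs :=
  TwoLegMomentsAt.budget_nonneg h hβ hU

end Model

/-! ## §2a The generic coupling door of the two-leg fits -/

/-- **`klTwoLegMomU R Zt Zs := cz·(23/200)/(2(|Zt|+|Zs|) + (4/3)|Gfr₁| + 1)`** — the coupling threshold below which moment budgets `Zt·U²`, `Zs·U²` meet
child 2's two-leg tolerances: `2Zt·U² ≤ cz|U|` and `2Zs·U² + (4/3)Gfr₁U² ≤ cz|U|·cDtmin(−1.2,−0.05)/2` (`twoLegMoment_fits_of_le_klTwoLegMomU`). -/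
def klTwoLegMomU (R : RenConsts) (Zt Zs : ℝ) : ℝ := R.cz * (23 / 200) / (2 * (|Zt| + |Zs|) + 4 / 3 * |R.Gfr 1| + 1)

/-- `0 < klTwoLegMomU R Zt Zs` whenever `0 < R.cz`. -/
theorem klTwoLegMomU_pos {R : RenConsts} (hcz : 0 < R.cz) (Zt Zs : ℝ) : 0 < klTwoLegMomU R Zt Zs := by
  unfold klTwoLegMomU; positivity

/-- **The two-leg FITS below the generic door**: for `0 < R.cz`, `0 < U ≤ klTwoLegMomU R Zt Zs`:
`2Zt·U² ≤ cz·|U|` and `2Zs·U² + (4/3)·Gfr₁·U² ≤ cz·|U|·(cDtmin(−1.2)(−0.05)/2)`. -/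
theorem twoLegMoment_fits_of_le_klTwoLegMomU {R : RenConsts} (hcz : 0 < R.cz) {U : ℝ} (hU : 0 < U) {Zt Zs : ℝ}
    (hUle : U ≤ klTwoLegMomU R Zt Zs) :
    2 * Zt * U ^ 2 ≤ R.cz * |U| ∧ 2 * Zs * U ^ 2 + 4 / 3 * R.Gfr 1 * U ^ 2 ≤ R.cz * |U| * (cDtmin (-1.2) (-0.05) / 2) := by
  have hD0 : 0 < 2 * (|Zt| + |Zs|) + 4 / 3 * |R.Gfr 1| + 1 := by positivity
  have habs : |U| = U := abs_of_pos hU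
  have h2' : U * (2 * (|Zt| + |Zs|) + 4 / 3 * |R.Gfr 1| + 1) ≤ R.cz * (23 / 200) := (le_div_iff₀ hD0).1 hUle
  have hcD := cDtmin_wide_ge
  have hc2 : (23 : ℝ) / 200 ≤ cDtmin (-1.2) (-0.05) / 2 := by linarith
  have hZt := le_abs_self Zt
  have hZs := le_abs_self Zs
  have hZs0 := abs_nonneg Zs
  have hZt0 := abs_nonneg Zt
  have hG := le_abs_self (R.Gfr 1)
  have hG0 := abs_nonneg (R.Gfr 1)
  rw [habs]
  refine ⟨?_, ?_⟩
  · have hle : 2 * Zt ≤ 2 * (|Zt| + |Zs|) + 4 / 3 * |R.Gfr 1| + 1 := by linarith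
    have hUD : U * (2 * Zt) ≤ R.cz * (23 / 200) := (mul_le_mul_of_nonneg_left hle hU.le).trans h2'
    calc 2 * Zt * U ^ 2 = U * (2 * Zt) * U := by ring
      _ ≤ R.cz * (23 / 200) * U := mul_le_mul_of_nonneg_right hUD hU.le
      _ ≤ R.cz * U := by nlinarith [mul_pos hcz hU]
  · have hle : 2 * Zs + 4 / 3 * R.Gfr 1 ≤ 2 * (|Zt| + |Zs|) + 4 / 3 * |R.Gfr 1| + 1 := by linarith
    have hUD : U * (2 * Zs + 4 / 3 * R.Gfr 1) ≤ R.cz * (23 / 200) := (mul_le_mul_of_nonneg_left hle hU.le).trans h2'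
    calc 2 * Zs * U ^ 2 + 4 / 3 * R.Gfr 1 * U ^ 2 = U * (2 * Zs + 4 / 3 * R.Gfr 1) * U := by ring
      _ ≤ R.cz * (23 / 200) * U := mul_le_mul_of_nonneg_right hUD hU.le
      _ ≤ R.cz * (cDtmin (-1.2) (-0.05) / 2) * U := mul_le_mul_of_nonneg_right (mul_le_mul_of_nonneg_left hc2 hcz.le) hU.le
      _ = R.cz * U * (cDtmin (-1.2) (-0.05) / 2) := by ring

end Summit.HubbardSuperconductivity.HubbardSuperconductivity.Theorems.KLRegimeSplit

namespace Summit.HubbardSuperconductivity.HubbardSuperconductivity.Theorems.EngineV8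

set_option linter.dupNamespace false -- summit = problem name (single-conjunct summit), D-0017

open Real Finset Literature.MathematicalPhysics.QuantumLattice Literature.Probability.LatticeModels GrassmannAlgebra
open Literature.MathematicalPhysics.QuantumLattice.FermiRG Literature.MathematicalPhysics.QuantumLattice.BandSectorCounting
open Summit.HubbardSuperconductivity.HubbardSuperconductivity.Theorems.KLProgrammeLegKernels
open Summit.HubbardSuperconductivity.HubbardSuperconductivity.Theorems.DispersionFlow
open Summit.HubbardSuperconductivity.HubbardSuperconductivity.Theorems.PerturbedFermiCurve
open Summit.HubbardSuperconductivity.HubbardSuperconductivity.Theorems.KLRegimeSplit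
open Summit.HubbardSuperconductivity.HubbardSuperconductivity.Theorems.TwoPointAssembly
open Summit.HubbardSuperconductivity.HubbardSuperconductivity.Theorems.TwoLegFourier

/-! ## §2 Consumers: the slope sizes, and stub (e) modulo the class-#7 export -/

/-- **THE TWO SLOPE SIZES FROM THE ATOM, every frame, every scale** (`0 < β`): `TwoLegMomentsAt L M Zt Zs β U μ K n` gives
`|klFieldStrength … K n k − 1| ≤ 2Zt·U²` at every torus momentum and `‖fderiv ℝ (evalM (symInterp L (klLocSelfEnergyRe … K n − K∘p))) q‖ ≤ 2Zs·U²` at every `q`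
(this lane's `abs_klFieldStrength_sub_one_le_of_dual_time_moment_sub_counter` / `twoLeg_sep_fderiv_of_dual_offDiag_moment`, p540781). -/
theorem twoLeg_slopeSizes_of_twoLegMomentsAt {L M : ℕ} [NeZero L] [NeZero M] {β : ℝ} (hβ : 0 < β) {U μ : ℝ} {K : TrigPolyC4v} {n : ℕ}
    {Zt Zs : ℝ} (h : TwoLegMomentsAt L M Zt Zs β U μ K n) :
    (∀ k : TorusSite 2 L, |klFieldStrength L M β U μ K n k - 1| ≤ 2 * Zt * U ^ 2) ∧
    ∀ q : Momentum, ‖fderiv ℝ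
      (evalM (symInterp L (fun p => klLocSelfEnergyRe L M β U μ K n p - K.eval (latticeMomentum L p)))) q‖ ≤ 2 * Zs * U ^ 2 := by
  refine ⟨fun k => ?_, fun q => ?_⟩
  · have h1 := abs_klFieldStrength_sub_one_le_of_dual_time_moment_sub_counter hβ U μ K n k h.1
    linarith
  · have h1 := twoLeg_sep_fderiv_of_dual_offDiag_moment hβ U μ K n h.2 q
    linarith

/-- **STUB (e) OF 20437 MODULO THE CLASS-#7 EXPORT, ALLOWANCE FORM — package `(G, Q)`, thresholds AND jet tables as binders** (the `_GQJ` convention):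
package rows `hGS`, `hQS`, `hQCL`; doors `c₃ ≤ klEngC₃3 P R`, `U₀c ≤ klEngU₀4 P R c`, `U₀c ≤ klE3U₀all R`; the stub's literal binders at `(G, Q)` with
`hJ : TwoLegReadJetBound L M cJ cJ' …`; then **`hD : TwoLegDualMomentsAt L M Zt Zs β U μ n`**, the allowance rows `hZa : 2Zt ≤ 2^10·e¹⁸κ₀⁴·klE3Acum R`,
`hSa : 2Zs ≤ 2^11·e¹⁸κ₀⁴·klE3Acum R`, and C1 `hcut`, C2 `hsp` ⇒ `TwoLegStepV17F2 L M G P Q R β U μ n`. -/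
theorem stub_twoLeg_step_of_twoLegDualMomentsAt_GQJ (G : GeoConsts) (Q : EngConsts) (cJ cJ' : ℕ → ℝ) {c₃ U₀c : ℝ} (P : SplitConsts)
    (R : RenConsts) (c : ℝ)
    (hGS : ∀ k, cJ k ≤ G.S k) (hQS : ∀ k, cJ' k ≤ Q.S' k) (hQCL : ∀ (β : ℝ) (n : ℕ), 0 ≤ Q.CL β n)
    (hc₃ : c₃ ≤ klEngC₃3 P R) (hU₀ : U₀c ≤ klEngU₀4 P R c) (hU₀all : U₀c ≤ klE3U₀all R) (hP : P.WF) (hR : R.WF2) (hc : 0 < c) (hc3 : c ≤ c₃)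
    (μ : ℝ) (hμ : μ ∈ klWindowC) (U : ℝ) (hU : 0 < U) (hUle : U ≤ U₀c) (β : ℝ) (hβ : klBetaMin ≤ β) (hβc : β ≤ Real.exp (c / U ^ 2))
    (L M : ℕ) [NeZero L] [NeZero M] (hL : klEngL₃ β U ≤ L) (hM : klEngM₃ β U L ≤ M)
    (n : ℕ) (hn1 : 1 ≤ n) (hn : n ≤ nScales β + 1) (hreg : IsKLRegime U c (-(n : ℤ)))
    (hhist : HistP klPredsV17F2 L M G P Q R β U μ 0 n)
    (hfr : FrameOK R U (nScales β) μ (klFlowFrameU L M β U μ n))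
    (hE : EngineBoundsAtV17F2 L M G P Q β U μ n)
    (hJ : TwoLegReadJetBound L M cJ cJ' β U μ (klFlowFrameU L M β U μ n) n)
    {Zt Zs : ℝ} (hD : TwoLegDualMomentsAt L M Zt Zs β U μ n)
    (hZa : 2 * Zt ≤ (2 : ℝ) ^ 10 * Real.exp 1 ^ 18 * Real.sqrt (2 * (7 + 1606732)) ^ 4 * klE3Acum R)
    (hSa : 2 * Zs ≤ (2 : ℝ) ^ 11 * Real.exp 1 ^ 18 * Real.sqrt (2 * (7 + 1606732)) ^ 4 * klE3Acum R)
    (hcut : ∀ (Mq : ℕ → ℕ) (L₁ M₁ M₂ : ℕ) [NeZero L₁] [NeZero M₁] [NeZero M₂], L ≤ L₁ → Q.M0 β L₁ ≤ M₁ → Mq L₁ ≤ M₁ → M₁ ≤ M₂ →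
      (∀ j < n, histV17F2 L₁ M₁ G P Q R β U μ j ∧ TwoLegSlopes L₁ M₁ R β U μ (klFlowFrameU L₁ M₁ β U μ j) j) →
      (∀ j < n, histV17F2 L₁ M₂ G P Q R β U μ j ∧ TwoLegSlopes L₁ M₂ R β U μ (klFlowFrameU L₁ M₂ β U μ j) j) →
        ∀ θ : ℝ, |klLocalPart L₁ M₁ β U μ (klFlowFrameU L₁ M₁ β U μ n) n θ -
          klLocalPart L₁ M₂ β U μ (klFlowFrameU L₁ M₂ β U μ n) n θ| ≤ Q.CL β n / 4 / L₁)
    (hsp : ∀ (Mq : ℕ → ℕ) (L₁ L₂ M₂ : ℕ) [NeZero L₁] [NeZero L₂] [NeZero M₂], L ≤ L₁ → L₁ ∣ L₂ → Q.M0 β L₁ ≤ M₂ → Mq L₁ ≤ M₂ →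
      Q.M0 β L₂ ≤ M₂ → Mq L₂ ≤ M₂ →
      (∀ j < n, histV17F2 L₁ M₂ G P Q R β U μ j ∧ TwoLegSlopes L₁ M₂ R β U μ (klFlowFrameU L₁ M₂ β U μ j) j) →
      (∀ j < n, histV17F2 L₂ M₂ G P Q R β U μ j ∧ TwoLegSlopes L₂ M₂ R β U μ (klFlowFrameU L₂ M₂ β U μ j) j) →
        ∀ θ : ℝ, |klLocalPart L₁ M₂ β U μ (klFlowFrameU L₁ M₂ β U μ n) n θ -
          klLocalPart L₂ M₂ β U μ (klFlowFrameU L₂ M₂ β U μ n) n θ| ≤ Q.CL β n / 4 / L₁) :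
    TwoLegStepV17F2 L M G P Q R β U μ n :=
  stub_twoLeg_step_of_dualMoments_GQJ G Q cJ cJ' P R c hGS hQS hQCL hc₃ hU₀ hU₀all hP hR hc hc3 μ hμ U hU hUle β hβ hβc L M hL hM n hn1 hn
    hreg hhist hfr hE hJ (Mt := Zt * U ^ 2) (Ms := Zs * U ^ 2) (Z := 2 * Zt) (S := 2 * Zs) hD.1 hD.2 (le_of_eq (by ring)) (le_of_eq (by ring))
    hZa hSa hcut hsp

/-- **STUB (e) OF 20437 MODULO THE CLASS-#7 EXPORT, GENERIC-THRESHOLD FORM** — as `…_GQJ` but the all-scales door `U₀c ≤ klE3U₀all R` and the two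
allowance rows are replaced by the single coupling door **`hU₀m : U₀c ≤ klTwoLegMomU R Zt Zs`** (for DEFERRED budgets `Zt, Zs`; the v2 U-door takes one more
`min` with `klC2U`, §4): `hD : TwoLegDualMomentsAt L M Zt Zs β U μ n` + C1/C2 ⇒ `TwoLegStepV17F2 L M G P Q R β U μ n`. -/
theorem stub_twoLeg_step_of_twoLegDualMomentsAt_thr_GQJ (G : GeoConsts) (Q : EngConsts) (cJ cJ' : ℕ → ℝ) {c₃ U₀c : ℝ} (P : SplitConsts)
    (R : RenConsts) (c : ℝ) {Zt Zs : ℝ}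
    (hGS : ∀ k, cJ k ≤ G.S k) (hQS : ∀ k, cJ' k ≤ Q.S' k) (hQCL : ∀ (β : ℝ) (n : ℕ), 0 ≤ Q.CL β n)
    (hc₃ : c₃ ≤ klEngC₃3 P R) (hU₀ : U₀c ≤ klEngU₀4 P R c) (hU₀m : U₀c ≤ klTwoLegMomU R Zt Zs) (hP : P.WF) (hR : R.WF2) (hc : 0 < c)
    (hc3 : c ≤ c₃)
    (μ : ℝ) (hμ : μ ∈ klWindowC) (U : ℝ) (hU : 0 < U) (hUle : U ≤ U₀c) (β : ℝ) (hβ : klBetaMin ≤ β) (hβc : β ≤ Real.exp (c / U ^ 2))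
    (L M : ℕ) [NeZero L] [NeZero M] (hL : klEngL₃ β U ≤ L) (hM : klEngM₃ β U L ≤ M)
    (n : ℕ) (hn1 : 1 ≤ n) (hn : n ≤ nScales β + 1) (hreg : IsKLRegime U c (-(n : ℤ)))
    (hhist : HistP klPredsV17F2 L M G P Q R β U μ 0 n)
    (hfr : FrameOK R U (nScales β) μ (klFlowFrameU L M β U μ n))
    (hE : EngineBoundsAtV17F2 L M G P Q β U μ n)
    (hJ : TwoLegReadJetBound L M cJ cJ' β U μ (klFlowFrameU L M β U μ n) n)
    (hD : TwoLegDualMomentsAt L M Zt Zs β U μ n)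
    (hcut : ∀ (Mq : ℕ → ℕ) (L₁ M₁ M₂ : ℕ) [NeZero L₁] [NeZero M₁] [NeZero M₂], L ≤ L₁ → Q.M0 β L₁ ≤ M₁ → Mq L₁ ≤ M₁ → M₁ ≤ M₂ →
      (∀ j < n, histV17F2 L₁ M₁ G P Q R β U μ j ∧ TwoLegSlopes L₁ M₁ R β U μ (klFlowFrameU L₁ M₁ β U μ j) j) →
      (∀ j < n, histV17F2 L₁ M₂ G P Q R β U μ j ∧ TwoLegSlopes L₁ M₂ R β U μ (klFlowFrameU L₁ M₂ β U μ j) j) →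
        ∀ θ : ℝ, |klLocalPart L₁ M₁ β U μ (klFlowFrameU L₁ M₁ β U μ n) n θ -
          klLocalPart L₁ M₂ β U μ (klFlowFrameU L₁ M₂ β U μ n) n θ| ≤ Q.CL β n / 4 / L₁)
    (hsp : ∀ (Mq : ℕ → ℕ) (L₁ L₂ M₂ : ℕ) [NeZero L₁] [NeZero L₂] [NeZero M₂], L ≤ L₁ → L₁ ∣ L₂ → Q.M0 β L₁ ≤ M₂ → Mq L₁ ≤ M₂ →
      Q.M0 β L₂ ≤ M₂ → Mq L₂ ≤ M₂ →
      (∀ j < n, histV17F2 L₁ M₂ G P Q R β U μ j ∧ TwoLegSlopes L₁ M₂ R β U μ (klFlowFrameU L₁ M₂ β U μ j) j) →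
      (∀ j < n, histV17F2 L₂ M₂ G P Q R β U μ j ∧ TwoLegSlopes L₂ M₂ R β U μ (klFlowFrameU L₂ M₂ β U μ j) j) →
        ∀ θ : ℝ, |klLocalPart L₁ M₂ β U μ (klFlowFrameU L₁ M₂ β U μ n) n θ -
          klLocalPart L₂ M₂ β U μ (klFlowFrameU L₂ M₂ β U μ n) n θ| ≤ Q.CL β n / 4 / L₁) :
    TwoLegStepV17F2 L M G P Q R β U μ n := by
  have _ := hP; have _ := hM; have _ := hn1; have _ := hreg; have _ := hhist; have _ := hE
  have hβ0 : 0 < β := lt_of_lt_of_le (by norm_num [klBetaMin]) hβ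
  obtain ⟨hzt, hms⟩ := twoLeg_slopeSizes_of_twoLegMomentsAt hβ0 ((twoLegDualMomentsAt_iff Zt Zs β U μ n).1 hD)
  obtain ⟨hfz, hfs⟩ := twoLegMoment_fits_of_le_klTwoLegMomU hR.2.2 hU (hUle.trans hU₀m)
  have hz : ∀ k ∈ klShell L μ (klFlowFrameU L M β U μ n) n,
      |klFieldStrength L M β U μ (klFlowFrameU L M β U μ n) n k - 1| ≤ R.cz * |U| := fun k _ => (hzt k).trans hfz
  have hm : ∀ q : Momentum, |frameLevel μ (klFlowFrameU L M β U μ n) q| ≤ klScale klE0 n →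
      ‖fderiv ℝ (evalM (symInterp L (fun p => klLocSelfEnergyRe L M β U μ (klFlowFrameU L M β U μ n) n p -
        (klFlowFrameU L M β U μ n).eval (latticeMomentum L p)))) q‖ ≤ 2 * Zs * U ^ 2 := fun q _ => hms q
  exact twoLegStepV17F2_of_jets_sepTubeGradient_nestedLegs_pkg G Q P hR hc (hc3.trans hc₃) hμ hU (hUle.trans hU₀) hβ hβc hL hn hfr (hQCL β n)
    hGS hQS hJ.1 hJ.2 hz hm hfs hcut hsp

end Summit.HubbardSuperconductivity.HubbardSuperconductivity.Theorems.EngineV8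

namespace Summit.HubbardSuperconductivity.HubbardSuperconductivity.Theorems.KLRegimeSplit

set_option linter.dupNamespace false -- summit = problem name (single-conjunct summit), D-0017

open Real Finset Literature.MathematicalPhysics.QuantumLattice Literature.Probability.LatticeModels
open Literature.MathematicalPhysics.QuantumLattice.FermiRG
open Summit.HubbardSuperconductivity.HubbardSuperconductivity.Theorems.KLProgrammeLegKernels
open Summit.HubbardSuperconductivity.HubbardSuperconductivity.Theorems.DispersionFlow
open Summit.HubbardSuperconductivity.HubbardSuperconductivity.Theorems.EngineV8

/-! ## §3 The step Prop (TowerExports §3 shape) -/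

/-- **`TwoLegMomentsStep P R Q₀ Zt Zs u`** — the tower's two-leg moment line as a step, VERBATIM the binder list of `LevelsUStep`: for every geometry package
`G` (`G.WF`), every raised `CR`-value `r ≥ Q₀.CR`, under the stub binders of the engine-flow skeleton, for couplings below the v1 door `klEngU₀9` AND below the
step's OWN deferred threshold `u r cc`, the history at the package `Q₀.withCR r`, the admissibility of `K_n` and the export at every `j < n` (each at its own
flow frame; dischargeable inside the producer's strong induction exactly as for `LevelsUStep`) give the export at `n` (from `n = 0`). -/
def TwoLegMomentsStep (P : SplitConsts) (R : RenConsts) (Q₀ : EngConsts) (Zt Zs : ℝ) (u : ℝ → ℝ → ℝ) : Prop :=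
  ∀ G : GeoConsts, G.WF → ∀ r : ℝ, Q₀.CR ≤ r →
    ∀ cc : ℝ, 0 < cc → cc ≤ klEngC₃6 P R →
      ∀ μ ∈ klWindowC, ∀ U : ℝ, 0 < U → U ≤ klEngU₀9 P R cc → U ≤ u r cc →
        ∀ β : ℝ, klBetaMin ≤ β → β ≤ Real.exp (cc / U ^ 2) →
          ∀ (L M : ℕ) [NeZero L] [NeZero M], klEngL₃ β U ≤ L → klEngM₃ β U L ≤ M →
            ∀ n : ℕ, n ≤ nScales β + 1 → IsKLRegime U cc (-(n : ℤ)) →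
              HistP klPredsV17F2 L M G P (Q₀.withCR r) R β U μ 0 n →
                FrameOK R U (nScales β) μ (klFlowFrameU L M β U μ n) →
                  (∀ j < n, TwoLegDualMomentsAt L M Zt Zs β U μ j) →
                    TwoLegDualMomentsAt L M Zt Zs β U μ n

/-- **An admissible moments package**: nonnegative coefficients and a POSITIVE threshold function. -/
def IsMomentsPkg (e : ℝ × ℝ × (ℝ → ℝ → ℝ)) : Prop := 0 ≤ e.1 ∧ 0 ≤ e.2.1 ∧ ∀ r cc, 0 < e.2.2 r cc

/-- The trivial package `(0, 0, 1)` is admissible. -/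
theorem isMomentsPkg_zero : IsMomentsPkg (0, 0, fun _ _ => 1) := ⟨le_rfl, le_rfl, fun _ _ => one_pos⟩

/-! ## §4 The deferred coefficients, threshold and door entry -/

section Deferred

variable (P : SplitConsts) (R : RenConsts) (Q₀ : EngConsts)

/-- The deferred moments package: SOME admissible `(Zt, Zs, u)` for which the tower's two-leg moment step holds, if one exists, else `(0, 0, 1)`. -/
def klTwoLegMomPkg : ℝ × ℝ × (ℝ → ℝ → ℝ) :=
  open scoped Classical in
  if h : ∃ e : ℝ × ℝ × (ℝ → ℝ → ℝ), IsMomentsPkg e ∧ TwoLegMomentsStep P R Q₀ e.1 e.2.1 e.2.2 then Classical.choose h else (0, 0, fun _ _ => 1)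

/-- **The deferred time-moment coefficient `klC2t P R Q₀`** (a closed term today; adequate the day `TwoLegMomentsStep` is proved for an admissible package). -/
def klC2t : ℝ := (klTwoLegMomPkg P R Q₀).1

/-- **The deferred space-moment coefficient `klC2s P R Q₀`**. -/
def klC2s : ℝ := (klTwoLegMomPkg P R Q₀).2.1

/-- **The deferred step threshold `klC2u P R Q₀ r cc`**. -/
def klC2u : ℝ → ℝ → ℝ := (klTwoLegMomPkg P R Q₀).2.2

/-- The deferred package is admissible (unconditionally). -/
theorem isMomentsPkg_klTwoLegMomPkg : IsMomentsPkg (klTwoLegMomPkg P R Q₀) := by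
  classical
  unfold klTwoLegMomPkg
  split_ifs with h
  · exact (Classical.choose_spec h).1
  · exact isMomentsPkg_zero

/-- `0 ≤ klC2t P R Q₀`. -/
theorem klC2t_nonneg : 0 ≤ klC2t P R Q₀ := (isMomentsPkg_klTwoLegMomPkg P R Q₀).1

/-- `0 ≤ klC2s P R Q₀`. -/
theorem klC2s_nonneg : 0 ≤ klC2s P R Q₀ := (isMomentsPkg_klTwoLegMomPkg P R Q₀).2.1

/-- `0 < klC2u P R Q₀ r cc` (unconditionally). -/
theorem klC2u_pos (r cc : ℝ) : 0 < klC2u P R Q₀ r cc := (isMomentsPkg_klTwoLegMomPkg P R Q₀).2.2 r cc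

/-- **`choose_spec`**: if the two-leg moment step holds for SOME admissible package, it holds for the deferred one. -/
theorem twoLegMomentsStep_klC2_of_exists
    (h : ∃ e : ℝ × ℝ × (ℝ → ℝ → ℝ), IsMomentsPkg e ∧ TwoLegMomentsStep P R Q₀ e.1 e.2.1 e.2.2) :
    TwoLegMomentsStep P R Q₀ (klC2t P R Q₀) (klC2s P R Q₀) (klC2u P R Q₀) := by
  classical
  have hpkg : klTwoLegMomPkg P R Q₀ = Classical.choose h := by
    unfold klTwoLegMomPkg; rw [dif_pos h]
  unfold klC2t klC2s klC2u
  rw [hpkg]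
  exact (Classical.choose_spec h).2

/-- The producer's entry point: an admissible package for which the step holds makes the deferred package adequate. -/
theorem twoLegMomentsStep_klC2_of {Zt Zs : ℝ} {u : ℝ → ℝ → ℝ} (hZt : 0 ≤ Zt) (hZs : 0 ≤ Zs) (hu : ∀ r cc, 0 < u r cc)
    (h : TwoLegMomentsStep P R Q₀ Zt Zs u) : TwoLegMomentsStep P R Q₀ (klC2t P R Q₀) (klC2s P R Q₀) (klC2u P R Q₀) :=
  twoLegMomentsStep_klC2_of_exists P R Q₀ ⟨(Zt, Zs, u), ⟨hZt, hZs, hu⟩, h⟩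

/-- **The U-DOOR ENTRY CANDIDATE `klC2U P R Q₀ r cc := min (klC2u P R Q₀ r cc) (klTwoLegMomU R (klC2t P R Q₀) (klC2s P R Q₀))`** — the step's own threshold
AND the generic two-leg fit door at the deferred coefficients (what `klEngU₀10` takes one more `min` with if class #7 is bought in the generic-threshold form). -/
def klC2U (r cc : ℝ) : ℝ := min (klC2u P R Q₀ r cc) (klTwoLegMomU R (klC2t P R Q₀) (klC2s P R Q₀))

/-- `0 < klC2U P R Q₀ r cc` whenever `0 < R.cz`. -/
theorem klC2U_pos {R : RenConsts} (hcz : 0 < R.cz) (P : SplitConsts) (Q₀ : EngConsts) (r cc : ℝ) : 0 < klC2U P R Q₀ r cc :=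
  lt_min (klC2u_pos P R Q₀ r cc) (klTwoLegMomU_pos hcz _ _)

/-- The door entry is below the step threshold. -/
theorem klC2U_le_klC2u (r cc : ℝ) : klC2U P R Q₀ r cc ≤ klC2u P R Q₀ r cc := min_le_left _ _

/-- The door entry is below the generic two-leg fit door at the deferred coefficients. -/
theorem klC2U_le_klTwoLegMomU (r cc : ℝ) : klC2U P R Q₀ r cc ≤ klTwoLegMomU R (klC2t P R Q₀) (klC2s P R Q₀) := min_le_right _ _

end Deferred

end Summit.HubbardSuperconductivity.HubbardSuperconductivity.Theorems.KLRegimeSplit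

end
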